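import Summits.CriticalPhenomena.PercolationContinuityZ3.Theses.PercPorousCritical
import Summits.CriticalPhenomena.PercolationContinuityZ3.Theorems.PercPorousCriticalFiniteClusterVolumeTailSummitEquiv
import Summits.CriticalPhenomena.PercolationContinuityZ3.Theorems.PercPorousCriticalFiniteClusterVolumeTailPosition
import Literature.Probability.Percolation.KestenZhangTailProofs
import Literature.Probability.Percolation.CriticalContinuityProofs
import HarnessLib

/-!
# EXEMPT-46 RE-EXAM (r1), route PercPorousCritical — typed companion: can the RESTATED crux `FiniteClusterVolumeTail` be REDIRECTED?

Crux-strategist `planner-cstrat-stmt-CriticalPhenomena-0943-r1-0`, 2026-08-17, route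
`route-CriticalPhenomena-PercPorousCritical` (thesis: quantitative BGN `Q` ⇒ porosity of the critical cluster ⇒ fat
finite-cluster tails at `p_c`, against a SAME-DENSITY tail upper bound K).
Prose census: `Cruxes/FiniteClusterVolumeTail/STRATEGY-CENSUS.md` (Part I = this re-exam).

This file is NOT a line (no stubs, no `sorry`). It TYPES the candidate pieces of every decomposition examined under the
human's BC2-REDIRECT certificate (a) k ≥ 2 load-bearing pieces · (b) assembly PROVED · (c) no piece gives the Statement
or the crux on its own · (d) a plan for every open piece — and PROVES the assemblies, so that the census can say exactly
which clause fails and why.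

* §0 `crux_iff_summit` — the frame: K ⟺ `PercolationContinuityZ3` is a LANDED theorem (p158843). Every decomposition of K
  is therefore a decomposition of the conjunct itself.
* §1 the exponent ladder `ExpLaw η` (`K = ExpLaw (2/3)`, monotone in `η`) and the in-thesis replacement leaf
  `SubSurfaceVolumeTail := ∀ η < 2/3, ExpLaw η` ("finite clusters at a percolating density have stretched-exponential
  volume tails with every exponent below surface order") — the ONLY same-density tail statement weaker than K that the
  route's porosity contradiction can still consume (`PorosityFromQBGN` delivers a gate exponent `δ < 2/3`).
* §2 decomposition α (in-thesis redirect) — ASSEMBLY PROVED: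
  `crux_of_alpha : GateCounting → PorosityFromQBGN → QuantitativeBGN → SubSurfaceVolumeTail → FiniteClusterVolumeTail`
  (the route's `closes` kernel re-run with exponent `η ∈ (δ, 2/3)` in place of `2/3`, then `summit → K`), together with
  `subSurface_iff_summit_of_Q` — modulo the route's other items the new leaf is again the conjunct (the bridge shape
  `T ∧ (T → S)` with `T = Q`), so its provability hinges on a same-density ENGINE for `ExpLaw η`, `η > 1/3`: none exists
  (clause (d)).
* §3 decomposition β (bare bridge `Q ∧ (Q → S)`) — trivial seam `crux_of_beta`; `qImpliesSummit_of_alpha` shows β's hard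
  piece has no plan other than α's leaf.
* §4 decomposition κ (radius law + boost) — typed; the radius law reaches only `ExpLaw (1/3)`.
* §5 `bridge_iff_jumpNegation` — the general shape: since `K ↔ S` and `θ(p_c) > 0 → ¬K` are landed, for EVERY
  intermediate `T` the bridge piece `T → K` is literally `θ(p_c) > 0 → ¬T`; a redirect of K through `T` is the pair
  {prove `T` at every percolating density, refute `T` at a percolating `p_c`}, and clause (d) needs an engine on each
  side (`subSurfaceBridge_of_Q`: for `T = SubSurfaceVolumeTail` the refutation side is this route, proved modulo its
  items; `boost_iff_jumpFatThird`: for `T = ExpLaw (1/3)` neither side has an engine).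
-/

noncomputable section

namespace Summit.CriticalPhenomena.PercolationContinuityZ3.Cruxes.FiniteClusterVolumeTail.ReExamPercPorousCritical

open MeasureTheory Filter Topology
open scoped Classical
open Literature.Probability.Percolation Literature.Probability.LatticeModels
open Summit.CriticalPhenomena.PercolationContinuityZ3.Theses.PercPorousCritical
  (FiniteClusterVolumeTail QuantitativeBGN PorosityFromQBGN GateCounting)
open Summit.CriticalPhenomena.PercolationContinuityZ3.Theorems.FiniteClusterVolumeTail
  (finiteClusterVolumeTail_iff_percolationContinuityZ3 finiteClusterVolumeTail_of_percolationContinuityZ3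
    percolationContinuityZ3_of_finiteClusterVolumeTail not_finiteClusterVolumeTail_of_theta_criticalProbI_pos)

/-! ## §0 Frame — the crux IS the conjunct (landed, unconditional) -/

/-- **K ⟺ PercolationContinuityZ3** (p158843, `Theorems/PercPorousCriticalFiniteClusterVolumeTailSummitEquiv.lean`).
Consequently clause (c) fails for any piece equal to K, and any honest decomposition of K decomposes the conjunct. -/
theorem crux_iff_summit : FiniteClusterVolumeTail ↔ _root_.PercolationContinuityZ3 :=
  finiteClusterVolumeTail_iff_percolationContinuityZ3

/-! ## §1 The exponent ladder -/

/-- The tail event `{m ≤ |C(0)| < ∞}`. -/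
def tailEvent (m : ℕ) : Set (BondConfig (Site 3)) :=
  {ω | (m : ℕ∞) ≤ (openCluster ω 0).encard ∧ (openCluster ω 0).Finite}

/-- `ExpLaw η`: at EVERY percolating density of `ℤ³`, `P_p(m ≤ |C(0)| < ∞) ≤ exp(-c m^η)` for some `c = c(p) > 0`.
`K = ExpLaw (2/3)` (surface order); `ExpLaw (1/3)` is what an exponential RADIUS tail gives; Hutchcroft's universal
`m^{-1/2}` is the only same-density upper bound in print. -/
def ExpLaw (η : ℝ) : Prop :=
  ∀ p : unitInterval, 0 < theta (zdGraph 3) (0 : Site 3) p → ∃ c : ℝ, 0 < c ∧ ∀ m : ℕ, 1 ≤ m →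
    (bondPercolation (zdGraph 3) p).real (tailEvent m) ≤ Real.exp (-(c * (m : ℝ) ^ η))

/-- K is the rung `η = 2/3`. -/
theorem crux_iff_expLaw : FiniteClusterVolumeTail ↔ ExpLaw ((2 : ℝ) / 3) := Iff.rfl

/-- The ladder is monotone: a larger exponent is a stronger law (`m ≥ 1`). -/
theorem expLaw_mono {η η' : ℝ} (hle : η' ≤ η) (h : ExpLaw η) : ExpLaw η' := by
  intro p hθ
  obtain ⟨c, hc, hb⟩ := h p hθ
  refine ⟨c, hc, fun m hm => (hb m hm).trans ?_⟩
  rw [Real.exp_le_exp]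
  have hm1 : (1 : ℝ) ≤ (m : ℝ) := by exact_mod_cast hm
  have hpow : (m : ℝ) ^ η' ≤ (m : ℝ) ^ η := Real.rpow_le_rpow_of_exponent_le hm1 hle
  have := mul_le_mul_of_nonneg_left hpow hc.le
  linarith

/-- **The in-thesis replacement leaf.** `SubSurfaceVolumeTail`: for every exponent `η < 2/3`, at every percolating
density the finite-cluster volume tail is `≤ exp(-c m^η)`. Written self-contained over Literature decls (fileable as a
statement item); `subSurface_iff` identifies it with `∀ η ∈ (0, 2/3), ExpLaw η`. A THEOREM for `p > p_c` (Kesten–Zhang);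
open only at a percolating `p_c`; NOT refuted in the jump world by the tree's strip-density bound (which gives
`≥ exp(-o(m^{2/3}))` only); refuted in the jump world by `Q` through this route's porosity (that is α's assembly). -/
def SubSurfaceVolumeTail : Prop :=
  ∀ η : ℝ, 0 < η → η < 2 / 3 → ∀ p : unitInterval,
    0 < Literature.Probability.Percolation.theta (Literature.Probability.LatticeModels.zdGraph 3) 0 p →
      ∃ c : ℝ, 0 < c ∧ ∀ m : ℕ, 1 ≤ m →
        (Literature.Probability.Percolation.bondPercolation (Literature.Probability.LatticeModels.zdGraph 3) p).real
            {ω | (m : ℕ∞) ≤ (Literature.Probability.Percolation.openCluster ω 0).encard ∧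
              (Literature.Probability.Percolation.openCluster ω 0).Finite} ≤
          Real.exp (-(c * (m : ℝ) ^ η))

theorem subSurface_iff : SubSurfaceVolumeTail ↔ ∀ η : ℝ, 0 < η → η < 2 / 3 → ExpLaw η := Iff.rfl

/-- K ⇒ the leaf (monotonicity of the ladder). -/
theorem subSurface_of_crux (hK : FiniteClusterVolumeTail) : SubSurfaceVolumeTail :=
  fun _ _ hη => expLaw_mono hη.le (crux_iff_expLaw.mp hK)

/-- The conjunct ⇒ the leaf (vacuity at `p_c` + Kesten–Zhang above `p_c`, through p153540). So the leaf is a CONSEQUENCE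
of the Statement — admissible as a crux only because α also USES it toward the Statement. -/
theorem subSurface_of_summit (h : _root_.PercolationContinuityZ3) : SubSurfaceVolumeTail :=
  subSurface_of_crux (finiteClusterVolumeTail_of_percolationContinuityZ3 h)

/-! ## §2 Decomposition α — the in-thesis redirect `K ⇐ Q ∧ SubSurfaceVolumeTail ∧ (supports)`

The route's deciding kernel, re-run with a general exponent: for `δ + 2e = η ≤ 1`, `e > 0`, the entropy factor
`((12x+1)M)^{(2x)^δ}` loses to `exp(-c x^η)` once `c x^e` beats `2 log(13M) + (2+|K|)/e`. -/

/-- Real-analysis kernel of `closes`, exponent `2/3` replaced by `η ≤ 1`. [folklore] -/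
theorem key (η δ K c M e x : ℝ) (hδ0 : 0 < δ) (he0 : 0 < e) (hsum : δ + e + e = η) (hη1 : η ≤ 1)
    (_hc : 0 < c) (hM1 : 1 ≤ M) (hx1 : 1 ≤ x)
    (hB : 2 * Real.log (13 * M) + 2 * e⁻¹ + |K| * e⁻¹ < c * x ^ e) :
    ((12 * x + 1) * M) ^ ((2 * x) ^ δ) * Real.exp (-(c * x ^ η)) < x ^ (-K) := by
  have hx0 : 0 < x := by linarith
  have hδ1 : δ ≤ 1 := by linarith
  have hM0 : 0 < M := by linarith
  have hb0 : 0 < (12 * x + 1) * M := by positivity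
  have hb1 : 1 ≤ (12 * x + 1) * M := one_le_mul_of_one_le_of_one_le (by linarith) hM1
  have hb13 : (12 * x + 1) * M ≤ 13 * M * x := by
    have h := mul_le_mul_of_nonneg_right (show 12 * x + 1 ≤ 13 * x by linarith) hM0.le
    linarith [h]
  have hlb : Real.log ((12 * x + 1) * M) ≤ Real.log (13 * M) + Real.log x := by
    have h := Real.log_le_log hb0 hb13
    rwa [Real.log_mul (by positivity) hx0.ne'] at h
  have hL0 : 0 ≤ Real.log (13 * M) := Real.log_nonneg (by linarith)
  have ht0 : 0 ≤ Real.log x := Real.log_nonneg hx1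
  have ht : Real.log x ≤ e⁻¹ * x ^ e := by
    have h := Real.log_le_rpow_div hx0.le he0
    rwa [div_eq_inv_mul] at h
  have hie0 : 0 < e⁻¹ := inv_pos.mpr he0
  have hE0 : 0 ≤ (2 * x) ^ δ := Real.rpow_nonneg (by linarith) δ
  have hxδ0 : 0 ≤ x ^ δ := Real.rpow_nonneg hx0.le δ
  have hE : (2 * x) ^ δ ≤ 2 * x ^ δ := by
    rw [Real.mul_rpow (by norm_num) hx0.le]
    have h2 : (2 : ℝ) ^ δ ≤ 2 := by
      calc (2 : ℝ) ^ δ ≤ (2 : ℝ) ^ (1 : ℝ) := Real.rpow_le_rpow_of_exponent_le (by norm_num) hδ1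
        _ = 2 := Real.rpow_one 2
    exact mul_le_mul_of_nonneg_right h2 hxδ0
  have hxδz : x ^ δ ≤ x ^ (δ + e) := Real.rpow_le_rpow_of_exponent_le hx1 (by linarith)
  have hyz : x ^ e ≤ x ^ (δ + e) := Real.rpow_le_rpow_of_exponent_le hx1 (by linarith)
  have hz : x ^ δ * x ^ e = x ^ (δ + e) := (Real.rpow_add hx0 δ e).symm
  have hz0 : 0 < x ^ (δ + e) := Real.rpow_pos_of_pos hx0 _
  have hxη : c * x ^ η = c * x ^ e * x ^ (δ + e) := by
    rw [← hsum, Real.rpow_add hx0 (δ + e) e]; ring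
  have i1 : Real.log ((12 * x + 1) * M) * (2 * x) ^ δ ≤ (Real.log (13 * M) + Real.log x) * (2 * x ^ δ) :=
    mul_le_mul hlb hE hE0 (by linarith)
  have i2 : Real.log x * x ^ δ ≤ e⁻¹ * x ^ (δ + e) := by
    calc Real.log x * x ^ δ ≤ (e⁻¹ * x ^ e) * x ^ δ := mul_le_mul_of_nonneg_right ht hxδ0
      _ = e⁻¹ * (x ^ δ * x ^ e) := by ring
      _ = e⁻¹ * x ^ (δ + e) := by rw [hz]
  have i3 : Real.log (13 * M) * x ^ δ ≤ Real.log (13 * M) * x ^ (δ + e) :=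
    mul_le_mul_of_nonneg_left hxδz hL0
  have i4 : K * Real.log x ≤ |K| * e⁻¹ * x ^ (δ + e) := by
    calc K * Real.log x ≤ |K| * Real.log x := mul_le_mul_of_nonneg_right (le_abs_self K) ht0
      _ ≤ |K| * (e⁻¹ * x ^ e) := mul_le_mul_of_nonneg_left ht (abs_nonneg K)
      _ ≤ |K| * (e⁻¹ * x ^ (δ + e)) :=
        mul_le_mul_of_nonneg_left (mul_le_mul_of_nonneg_left hyz hie0.le) (abs_nonneg K)
      _ = |K| * e⁻¹ * x ^ (δ + e) := by ring
  have i5 : (2 * Real.log (13 * M) + 2 * e⁻¹ + |K| * e⁻¹) * x ^ (δ + e) < c * x ^ e * x ^ (δ + e) :=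
    mul_lt_mul_of_pos_right hB hz0
  have main : Real.log ((12 * x + 1) * M) * (2 * x) ^ δ + -(c * x ^ η) < Real.log x * -K := by
    rw [hxη]; linarith [i1, i2, i3, i4, i5]
  have hA : ((12 * x + 1) * M) ^ ((2 * x) ^ δ) = Real.exp (Real.log ((12 * x + 1) * M) * (2 * x) ^ δ) :=
    Real.rpow_def_of_pos hb0 _
  have hR : x ^ (-K) = Real.exp (Real.log x * -K) := Real.rpow_def_of_pos hx0 _
  rw [hA, hR, ← Real.exp_add, Real.exp_lt_exp]
  exact main

/-- **α's assembly, Statement form (PROVED).** Gate counting + quantitative Cerf–Dembin porosity + a BGN rate `Q` +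
the SUB-surface same-density tail law give `θ(p_c) = 0`: porosity delivers a gate exponent `δ < 2/3`, and the leaf is
invoked at the single exponent `η = (δ + 2/3)/2 ∈ (δ, 2/3)` at `p = p_c`. -/
theorem summit_of_alpha (hG : GateCounting) (hP : PorosityFromQBGN) (hQ : QuantitativeBGN)
    (hS : SubSurfaceVolumeTail) : _root_.PercolationContinuityZ3 := by
  refine (Literature.Probability.Percolation.percolationContinuityZ3_iff).mpr ?_
  by_contra hne
  have hθ : 0 < Literature.Probability.Percolation.theta (Literature.Probability.LatticeModels.zdGraph 3)
      (0 : Literature.Probability.LatticeModels.Site 3) (Literature.Probability.Percolation.criticalProbI 3) :=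
    lt_of_le_of_ne MeasureTheory.measureReal_nonneg (Ne.symm hne)
  have hp0 : 0 < ((Literature.Probability.Percolation.criticalProbI 3 : unitInterval) : ℝ) := by
    rw [Literature.Probability.Percolation.coe_criticalProbI]
    exact Literature.Probability.Percolation.criticalProb_zd_pos 3 (by norm_num)
  have hp1 : ((Literature.Probability.Percolation.criticalProbI 3 : unitInterval) : ℝ) < 1 := by
    rw [Literature.Probability.Percolation.coe_criticalProbI]
    exact Literature.Probability.Percolation.criticalProb_zd_lt_one (by norm_num)
  obtain ⟨δ, K, hδ0, hδ23, hfreq⟩ := hP hθ hQ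
  -- the leaf at the exponent `η = (δ + 2/3)/2`
  obtain ⟨η, hη⟩ : ∃ η : ℝ, η = (δ + 2 / 3) / 2 := ⟨_, rfl⟩
  have hη0 : 0 < η := by rw [hη]; linarith
  have hη23 : η < 2 / 3 := by rw [hη]; linarith
  have hη1 : η ≤ 1 := by linarith
  obtain ⟨c, hc, hKb⟩ := hS η hη0 hη23 (Literature.Probability.Percolation.criticalProbI 3) hθ
  obtain ⟨e, he⟩ : ∃ e : ℝ, e = (η - δ) / 2 := ⟨_, rfl⟩
  have he0 : 0 < e := by rw [he, hη]; linarith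
  have hsum : δ + e + e = η := by rw [he]; ring
  have hB : ∀ᶠ s : ℕ in Filter.atTop,
      2 * Real.log (13 * max 1 (((Literature.Probability.Percolation.criticalProbI 3 : unitInterval) : ℝ) /
        (1 - ((Literature.Probability.Percolation.criticalProbI 3 : unitInterval) : ℝ)))) + 2 * e⁻¹ + |K| * e⁻¹ <
        c * (s : ℝ) ^ e :=
    tendsto_natCast_atTop_atTop.eventually
      (((tendsto_rpow_atTop he0).const_mul_atTop hc).eventually_gt_atTop _)
  obtain ⟨s, hs, hsB, hs1⟩ := (hfreq.and_eventually (hB.and (Filter.eventually_ge_atTop 1))).exists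
  have hx1 : (1 : ℝ) ≤ (s : ℝ) := by exact_mod_cast hs1
  have hGs := hG (Literature.Probability.Percolation.criticalProbI 3) hp0 hp1 δ hδ0.le s hs1
  have hKs := hKb s hs1
  have hM1 : (1 : ℝ) ≤ max 1 (((Literature.Probability.Percolation.criticalProbI 3 : unitInterval) : ℝ) /
      (1 - ((Literature.Probability.Percolation.criticalProbI 3 : unitInterval) : ℝ))) := le_max_left _ _
  have hlt := key η δ K c _ e (s : ℝ) hδ0 he0 hsum hη1 hc hM1 hx1 hsB
  have hA0 : (0 : ℝ) ≤ ((12 * (s : ℝ) + 1) * max 1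
      (((Literature.Probability.Percolation.criticalProbI 3 : unitInterval) : ℝ) /
        (1 - ((Literature.Probability.Percolation.criticalProbI 3 : unitInterval) : ℝ)))) ^ ((2 * (s : ℝ)) ^ δ) :=
    Real.rpow_nonneg (mul_nonneg (by positivity) (le_trans zero_le_one hM1)) _
  exact absurd (lt_of_le_of_lt (hs.trans (hGs.trans (mul_le_mul_of_nonneg_left hKs hA0))) hlt) (lt_irrefl _)

/-- **α's assembly, crux form (PROVED)** — clause (b) of the redirect certificate for the piece set
`{GateCounting, PorosityFromQBGN, QuantitativeBGN, SubSurfaceVolumeTail}`: they imply the crux (through the conjunct and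
the landed `summit → K`). NOT a trivial seam. -/
theorem crux_of_alpha (hG : GateCounting) (hP : PorosityFromQBGN) (hQ : QuantitativeBGN)
    (hS : SubSurfaceVolumeTail) : FiniteClusterVolumeTail :=
  finiteClusterVolumeTail_of_percolationContinuityZ3 (summit_of_alpha hG hP hQ hS)

/-- **Modulo the route's other items, the new leaf is the conjunct** (bridge structure of α): given gate counting,
porosity and `Q`, `SubSurfaceVolumeTail ↔ PercolationContinuityZ3`. So the leaf can only be PROVED by an argument that
proves `θ(p_c) = 0` (if `Q` is true) — its "plan" must be a same-density engine for `ExpLaw η`, `η > 1/3`, and none is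
known: clause (d) fails. -/
theorem subSurface_iff_summit_of_Q (hG : GateCounting) (hP : PorosityFromQBGN) (hQ : QuantitativeBGN) :
    SubSurfaceVolumeTail ↔ _root_.PercolationContinuityZ3 :=
  ⟨summit_of_alpha hG hP hQ, subSurface_of_summit⟩

/-- Jump form of α: in a jump world with a BGN rate (and the two supports), the sub-surface law FAILS at `p_c` —
finite clusters are fatter than `exp(-m^η)` for some `η < 2/3` (in fact for every `η > δ(a)`). -/
theorem not_subSurface_of_theta_pos_of_Q (hG : GateCounting) (hP : PorosityFromQBGN) (hQ : QuantitativeBGN)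
    (hθ : 0 < theta (zdGraph 3) (0 : Site 3) (criticalProbI 3)) : ¬ SubSurfaceVolumeTail := fun hS =>
  absurd ((Literature.Probability.Percolation.percolationContinuityZ3_iff).mp (summit_of_alpha hG hP hQ hS)) hθ.ne'

/-! ## §3 Decomposition β — the bare bridge `K ⇐ Q ∧ (Q → S)` -/

/-- β's second piece: "a BGN rate implies continuity". -/
def QImpliesSummit : Prop := QuantitativeBGN → _root_.PercolationContinuityZ3

/-- β's assembly (PROVED; `trivial_seam`: modus ponens + the landed `summit → K`). -/
theorem crux_of_beta (hQ : QuantitativeBGN) (hB : QImpliesSummit) : FiniteClusterVolumeTail :=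
  finiteClusterVolumeTail_of_percolationContinuityZ3 (hB hQ)

/-- β's hard piece is implied by the Statement (it is a consequence) … -/
theorem qImpliesSummit_of_summit (h : _root_.PercolationContinuityZ3) : QImpliesSummit := fun _ => h

/-- … and its only known plan is α: `QImpliesSummit ⇐ GateCounting ∧ PorosityFromQBGN ∧ SubSurfaceVolumeTail`.
So β inherits α's clause-(d) failure at the leaf `SubSurfaceVolumeTail`. -/
theorem qImpliesSummit_of_alpha (hG : GateCounting) (hP : PorosityFromQBGN) (hS : SubSurfaceVolumeTail) :
    QImpliesSummit := fun hQ => summit_of_alpha hG hP hQ hS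

/-! ## §4 Decomposition κ — radius law + exponent boost -/

/-- κ's first piece: same-density EXPONENTIAL RADIUS tail of finite clusters,
`θ(p) > 0 ⇒ P_p(C(0) finite and reaches sup-distance n) ≤ exp(-c n)`. A theorem for `p > p_c` (Grimmett 1999
Thm (8.18)/(8.21) via Grimmett–Marstrand); open at a percolating `p_c`; NOT known to be conjunct-equivalent (it does not
pass through local uniqueness and is not refuted by the strip/blocking portrait, which builds finite clusters of radius
`n` at cost `e^{-o(n²)}` only). It yields `ExpLaw (1/3)` at best (volume `m` forces radius `≥ m^{1/3}/2`). -/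
def FiniteClusterRadiusTail : Prop :=
  ∀ p : unitInterval, 0 < theta (zdGraph 3) (0 : Site 3) p → ∃ c : ℝ, 0 < c ∧ ∀ n : ℕ, 1 ≤ n →
    (bondPercolation (zdGraph 3) p).real
        {ω | (∃ x ∈ openCluster ω (0 : Site 3), ∃ i : Fin 3, (n : ℤ) ≤ |x i|) ∧ (openCluster ω (0 : Site 3)).Finite} ≤
      Real.exp (-(c * (n : ℝ)))

/-- κ's pieces and (trivial) assembly: radius law, radius ⇒ `ExpLaw (1/3)` (routine isoperimetry of boxes), and the
BOOST `ExpLaw (1/3) → K`. -/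
theorem crux_of_kappa (hR : FiniteClusterRadiusTail) (h13 : FiniteClusterRadiusTail → ExpLaw ((1 : ℝ) / 3))
    (hBoost : ExpLaw ((1 : ℝ) / 3) → FiniteClusterVolumeTail) : FiniteClusterVolumeTail :=
  hBoost (h13 hR)

/-- The Statement gives the boost piece outright (it is a consequence of S). -/
theorem boost_of_summit (h : _root_.PercolationContinuityZ3) : ExpLaw ((1 : ℝ) / 3) → FiniteClusterVolumeTail :=
  fun _ => finiteClusterVolumeTail_of_percolationContinuityZ3 h

/-! ## §5 The general shape of every bridge redirect of K

Because `K ↔ S` and `¬S → ¬K` are LANDED, for ANY intermediate statement `T` the bridge piece `T → K` is literally the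
jump-world negation `θ(p_c) > 0 → ¬T`. A redirect `K ⇐ T ∧ (T → K)` is therefore the pair
{prove `T` at every percolating density, refute `T` at a percolating `p_c`} — clause (d) asks for an engine on EACH side.
(`bridge_iff_jumpNegation`; instances: `T = SubSurfaceVolumeTail` — refutation side = α, PROVED modulo the route's items,
proof side = no engine; `T = ExpLaw (1/3)` / the radius law — neither side has an engine; `T = TwoArmsSmall`,
`T =` anchored isoperimetry, `T = K` — refutation side LANDED, hence `T ↔ S` and clause (c) fails.) -/

/-- **Bridge ≡ jump-negation.** For every `T`: `(T → K) ↔ (θ(p_c) > 0 → ¬T)`. -/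
theorem bridge_iff_jumpNegation (T : Prop) :
    (T → FiniteClusterVolumeTail) ↔ (0 < theta (zdGraph 3) (0 : Site 3) (criticalProbI 3) → ¬ T) := by
  constructor
  · exact fun hB hθ hT => not_finiteClusterVolumeTail_of_theta_criticalProbI_pos hθ (hB hT)
  · intro hN hT
    by_cases h0 : theta (zdGraph 3) (0 : Site 3) (criticalProbI 3) = 0
    · exact finiteClusterVolumeTail_of_percolationContinuityZ3
        ((Literature.Probability.Percolation.percolationContinuityZ3_iff).mpr h0)
    · exact absurd hT (hN (lt_of_le_of_ne measureReal_nonneg (Ne.symm h0)))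

/-- Instance `T = SubSurfaceVolumeTail`: the bridge piece of α/β is "in a jump world the sub-surface law fails at `p_c`",
and THAT is exactly what the route's porosity items prove from `Q` (`not_subSurface_of_theta_pos_of_Q`). -/
theorem subSurfaceBridge_of_Q (hG : GateCounting) (hP : PorosityFromQBGN) (hQ : QuantitativeBGN) :
    SubSurfaceVolumeTail → FiniteClusterVolumeTail :=
  (bridge_iff_jumpNegation _).mpr (not_subSurface_of_theta_pos_of_Q hG hP hQ)

/-- Instance `T = ExpLaw (1/3)` (κ's boost): the boost piece is "in a jump world finite clusters at `p_c` are fatter than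
every third-law `exp(-c m^{1/3})`" — two orders below what the tree's strip/blocking construction gives
(`exp(-o(m^{2/3}))`); no engine. -/
theorem boost_iff_jumpFatThird :
    (ExpLaw ((1 : ℝ) / 3) → FiniteClusterVolumeTail) ↔
      (0 < theta (zdGraph 3) (0 : Site 3) (criticalProbI 3) → ¬ ExpLaw ((1 : ℝ) / 3)) :=
  bridge_iff_jumpNegation _

end Summit.CriticalPhenomena.PercolationContinuityZ3.Cruxes.FiniteClusterVolumeTail.ReExamPercPorousCritical

end
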